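import Literature.Probability.RandomPlanarGeometry.HexSAWPolygonSupermult
import HarnessLib

/-!
# Sharp supermultiplicativity of the honeycomb polygon numbers: `q_N(ℍ) · q_M(ℍ) ≤ q_{N+M−2}(ℍ)`,
# hence `q_N(ℍ) ≤ μ_ℍ^{N−2}` — two polygons merged along a SHARED BOND

Topic `Literature/Probability/RandomPlanarGeometry` (lane «pcv-sawmu», a-p4 g16; on the frame of `HexSAWPolygonConcatenation.lean` /
`HexSAWPolygonSupermult.lean`: canonical rooted polygons `PolygonConcat.canonEnd n` (`#canonEnd n = q_{n+1}(ℍ)`, `card_canonEnd`), the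
translated second polygon `detour`, its decoding `detour_decode`, the cut-time argument `cut_le_of_glue_eq`).

Madras–Slade's concatenation (Theorem 3.2.3 (3.2.2), `ℤ^d`: delete one bond of each polygon, add two connecting bonds — length
`N + M`; Whittington, LNP 775 (2.3)) became on `ℍ` the BRICK JOIN of `HexSAWPolygonConcatenation.glue` (length `N + M + 2`,
`HexSAWPolygonSupermult.hexPolygonNumber_mul_le`).  Here the two polygons are merged along ONE SHARED BOND instead (length `N + M − 2`):
`P ∈ canonEnd n` is cut at the TOPMOST vertical bond `e = {(X,y),(X,y+1)}` of its rightmost column `X` (`jTop`; every column-`X` vertex of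
`P` has height `≤ y+1`), `Q ∈ canonEnd m` is rooted at its lexicographically smallest vertex, so its root bond `{0, (0,1)}` is the bottom
bond of its leftmost column and every column-`0` vertex of `Q` has height `≥ 0`; translating `Q` by `(X, y)` (an even vector: a brick-wall
automorphism) puts its root bond onto `e`, with `P ⊆ {x ≤ X}`, `Q + (X,y) ⊆ {x ≥ X}` and `P ∩ (Q + (X,y)) = e` exactly.  Deleting `e` from both
leaves a self-avoiding polygon of length `N + M − 2` whose lexicographically smallest vertex is still `P`'s root: the walk `merge`.  The pair
`(P, Q)` is recovered from it by the tree's cut-time argument (the merged walk enters column `X + 1` right after the cut and right before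
re-entering `P`) and `detour_decode`.

Tree lemmas called (frame `HexSAWPolygonConcatenation.lean`: `mem_endAt_iff`, `adj_cases`, `vertical_cases`, `vertical_unique`, `adj_of_mem`,
`adj_last_zero`, `cycB_exists`, `cycF_exists`, `sameDir`, `detour`, `detour_of_same`, `detour_of_not_same`, `DetourOK`, `detour_decode`;
`HexSAWPolygonSupermult.lean`: `canonEnd`, `mem_canonEnd`, `apply_one_of_mem_canonEnd`, `detourOK_zero`, `card_canonEnd`, `hexPolygonNumber_le_pow`;
`HexSAWBrickWallPieces.adj_add_iff_of_even`; `HexSAWLattice.hexConnectiveConstant_eq_of_thm1` with `DuminilCopinSmirnov2012_thm1_holds`).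

## Contents (namespaces `…SAW.HexBW.PolygonConcat` / `…SAW.HexBW`; all PROVED)

* `exists_vertical_top`, `jTop`, `jTop_spec` — the topmost vertical bond of the rightmost column;
* `spath` (the second polygon minus its root bond, translated onto the cut bond: the tree's `detour … 0` shifted back by `2e₀`),
  `spath_start/finish/adj/injOn/col/low/one/pred`;
* `merge`, `merge_mem_endAt`, `merge_mem_canonEnd`, `merge_cut_le`, `merge_injOn`;
* **`card_canonEnd_mul_le_sharp : #canonEnd n · #canonEnd m ≤ #canonEnd (n + m − 1)`** (`n, m ≥ 2`);
* **`hexPolygonNumber_mul_le_sharp : q_N(ℍ) · q_M(ℍ) ≤ q_{N+M−2}(ℍ)`** (`N, M ≥ 3`; implies the tree's `+2` form by `q_K ≤ q_{K+4}`);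
* `hexPolygonNumber_le_add_sub_two_of_pos : q_M(ℍ) > 0 → q_N(ℍ) ≤ q_{N+M−2}(ℍ)`, `hexPolygonNumber_pow_le_sharp : q_N^k ≤ q_{k(N−2)+2}`;
* **`hexPolygonNumber_le_pow_sharp : q_N(ℍ) ≤ μ_ℍ^{N−2}`** (`N ≥ 3`; the tree's `hexPolygonNumber_le_pow` has `μ_ℍ^{N+2}`) and
  `hexPolygonNumber_le_sqrt_pow_sharp : q_N(ℍ) ≤ √(2+√2)^{N−2}` (Duminil-Copin–Smirnov's value).

Consequence left to the sequel importing the lane's `HexSAWPolygonMonotone.lean` (`q_12(ℍ) ≥ 1`): `q_N(ℍ) ≤ q_{N+10}(ℍ)` for every `N ≥ 3`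
(`hexPolygonNumber_le_add_sub_two_of_pos` with `M = 12`), so that the honeycomb polygon numbers grow in every even step `k ≥ 4` except `6`.

Sources: N. Madras, G. Slade, *The Self-Avoiding Walk* (1993), Theorem 3.2.3 (3.2.2)–(3.2.5) pp. 64–65 [MadrasSlade1993]; S. G. Whittington,
LNP 775 (2009) §2.2–2.3, (2.3)–(2.6) pp. 25–26 [Whittington2009LatticePolygons]; J. M. Hammersley, Proc. Camb. Phil. Soc. 57 (1961) 516
(supermultiplicativity of polygon counts).  Status in print: the bond-SHARING variant for self-avoiding polygons is not located in the held
corpus (it is the standard device for cell animals counted by area); NEW IN WRITING for `ℍ` (modest): the parity bookkeeping and the constant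
`μ_ℍ^{N−2}`.
-/

noncomputable section

open Finset Function Filter Topology Literature.Probability.LatticeModels Literature.Probability.Percolation SimpleGraph

namespace Literature.Probability.RandomPlanarGeometry.SAW

namespace HexBW

namespace PolygonConcat

/-! ### Small coordinate facts -/

/-- `e₀ 0 = 1`. [folklore; lane plumbing] [cite: MadrasSlade1993, §1.1] -/
private theorem ej_e0_zero : ((Pi.single 0 1 : Site 2) : Site 2) 0 = 1 := by simp

/-- `e₀ 1 = 0`. [folklore; lane plumbing] [cite: MadrasSlade1993, §1.1] -/
private theorem ej_e0_one : ((Pi.single 0 1 : Site 2) : Site 2) 1 = 0 := by simp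

/-- Two sites of `ℤ²` are equal iff both coordinates agree. [folklore; lane plumbing] [cite: MadrasSlade1993, §1.1] -/
private theorem ej_site_eq_iff {x y : Site 2} : x = y ↔ x 0 = y 0 ∧ x 1 = y 1 := by
  constructor
  · rintro rfl; exact ⟨rfl, rfl⟩
  · rintro ⟨h0, h1⟩; funext i; fin_cases i <;> assumption

/-! ### The topmost vertical bond of the rightmost column -/

section TopCut

variable {n : ℕ} {ω : ℕ → Site 2}

/-- **Top cut.** For `n ≥ 2` some walk bond `{ω(j), ω(j+1)}` of a rooted polygon is a vertical bond of its rightmost column `X`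
lying ABOVE every other vertex of that column: take the lexicographically largest vertex `(X, h)` of the polygon; it has no right
neighbour and no upper neighbour on the polygon, so its two polygon bonds are the left one and the vertical one DOWN to `(X, h−1)`.
[cite: MadrasSlade1993, §3.2 (proof of Theorem 3.2.3: "let `p` be its lexicographically largest point")] -/
theorem exists_vertical_top (hω : ω ∈ endAt n (Pi.single 0 1 : Site 2)) (hn : 2 ≤ n) :
    ∃ j, j < n ∧ ω (j + 1) 0 = ω j 0 ∧ (∀ i, i ≤ n → ω i 0 ≤ ω j 0) ∧
      (∀ i, i ≤ n → ω i 0 = ω j 0 → ω i 1 ≤ max (ω j 1) (ω (j + 1) 1)) := by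
  classical
  obtain ⟨⟨h0, -, hbw, hinj⟩, hn'⟩ := mem_endAt_iff.1 hω
  -- the maximal column `X`
  obtain ⟨i₁, hi₁, hmax₁⟩ := exists_max_image (range (n + 1)) (fun i => ω i 0) ⟨0, by simp⟩
  simp only [mem_range, Nat.lt_succ_iff] at hi₁ hmax₁
  set X : ℤ := ω i₁ 0 with hX
  -- the highest vertex of column `X`
  set S : Finset ℕ := (range (n + 1)).filter fun i => ω i 0 = X with hS
  have hSne : S.Nonempty := ⟨i₁, by rw [hS, Finset.mem_filter, Finset.mem_range]; exact ⟨by omega, hX.symm⟩⟩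
  obtain ⟨i₀, hi₀S, hmax₀⟩ := exists_max_image S (fun i => ω i 1) hSne
  have hi₀ : i₀ ≤ n ∧ ω i₀ 0 = X := by
    rw [hS, Finset.mem_filter, Finset.mem_range] at hi₀S; exact ⟨by omega, hi₀S.2⟩
  have hmaxX : ∀ i, i ≤ n → ω i 0 ≤ X := hmax₁
  have hmaxH : ∀ i, i ≤ n → ω i 0 = X → ω i 1 ≤ ω i₀ 1 := fun i hi hiX =>
    hmax₀ i (by rw [hS, Finset.mem_filter, Finset.mem_range]; exact ⟨by omega, hiX⟩)
  -- `i₀ ≠ 0`: the root `0` has column `0 < 1 = (ω n) 0 ≤ X`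
  have hX1 : 1 ≤ X := by have := hmaxX n le_rfl; rw [hn'] at this; simpa using this
  have hi₀0 : i₀ ≠ 0 := by
    rintro rfl; rw [h0] at hi₀; simp at hi₀; omega
  -- a neighbour of `ω i₀` on the polygon which is not the left neighbour is the vertical neighbour `(X, h-1)`
  have key : ∀ z : Site 2, brickWallGraph.Adj (ω i₀) z → (∃ i, i ≤ n ∧ ω i = z) →
      ¬ (z 0 = X - 1 ∧ z 1 = ω i₀ 1) → (z 0 = X ∧ z 1 + 1 = ω i₀ 1) := by
    intro z hadj ⟨i, hi, hiz⟩ hnot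
    have hzX : z 0 ≤ X := by rw [← hiz]; exact hmaxX i hi
    rcases adj_cases hadj with ⟨h1, -⟩ | ⟨h1, h2⟩ | h1
    · rw [hi₀.2] at h1; omega
    · exact absurd ⟨by rw [hi₀.2] at h1; omega, h2⟩ hnot
    · have hz0 : z 0 = X := by rw [h1, hi₀.2]
      refine ⟨hz0, ?_⟩
      have hle : z 1 ≤ ω i₀ 1 := by rw [← hiz] at hz0 ⊢; exact hmaxH i hi hz0
      rcases vertical_cases hadj h1 with ⟨hy, -⟩ | ⟨hy, -⟩
      · omega
      · omega
  -- the two polygon neighbours of `ω i₀`: predecessor `ω (i₀-1)` and successor (`ω (i₀+1)`, or `ω 0` when `i₀ = n`)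
  have hpred_adj : brickWallGraph.Adj (ω i₀) (ω (i₀ - 1)) := by
    have := hbw (i₀ - 1) (by omega); rw [show i₀ - 1 + 1 = i₀ by omega] at this; exact this.symm
  have hpred_mem : ∃ i, i ≤ n ∧ ω i = ω (i₀ - 1) := ⟨i₀ - 1, by omega, rfl⟩
  -- successor site
  set sc : Site 2 := if i₀ < n then ω (i₀ + 1) else ω 0 with hsc
  have hsucc_adj : brickWallGraph.Adj (ω i₀) sc := by
    by_cases hlt : i₀ < n
    · rw [hsc, if_pos hlt]; exact hbw i₀ hlt
    · rw [hsc, if_neg hlt]; obtain rfl : i₀ = n := by omega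
      exact adj_last_zero hω
  have hsucc_mem : ∃ i, i ≤ n ∧ ω i = sc := by
    by_cases hlt : i₀ < n
    · exact ⟨i₀ + 1, by omega, by rw [hsc, if_pos hlt]⟩
    · exact ⟨0, by omega, by rw [hsc, if_neg hlt]⟩
  have hne : ω (i₀ - 1) ≠ sc := by
    by_cases hlt : i₀ < n
    · rw [hsc, if_pos hlt]; intro h
      have := hinj (show i₀ - 1 ∈ {i | i ≤ n} by simp; omega) (show i₀ + 1 ∈ {i | i ≤ n} by simp; omega) h
      omega
    · rw [hsc, if_neg hlt]; intro h
      have := hinj (show i₀ - 1 ∈ {i | i ≤ n} by simp; omega) (show 0 ∈ {i | i ≤ n} by simp) h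
      omega
  -- not both are the left neighbour
  by_cases hp : (ω (i₀ - 1)) 0 = X - 1 ∧ (ω (i₀ - 1)) 1 = ω i₀ 1
  · -- then the successor is the vertical one: `j = i₀`, and `i₀ < n`
    have hs : ¬ (sc 0 = X - 1 ∧ sc 1 = ω i₀ 1) := by
      intro hs; exact hne (ej_site_eq_iff.2 ⟨by rw [hp.1, hs.1], by rw [hp.2, hs.2]⟩)
    obtain ⟨hs0, hs1⟩ := key sc hsucc_adj hsucc_mem hs
    have hlt : i₀ < n := by
      by_contra hlt; rw [hsc, if_neg hlt, h0] at hs0; simp at hs0; omega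
    rw [hsc, if_pos hlt] at hs0 hs1
    refine ⟨i₀, hlt, by rw [hs0, hi₀.2], fun i hi => by rw [hi₀.2]; exact hmaxX i hi, fun i hi hiX => ?_⟩
    rw [hi₀.2] at hiX
    exact le_max_of_le_left (hmaxH i hi hiX)
  · -- the predecessor is the vertical one: `j = i₀ - 1`
    obtain ⟨hp0, hp1⟩ := key _ hpred_adj hpred_mem hp
    refine ⟨i₀ - 1, by omega, ?_, fun i hi => ?_, fun i hi hiX => ?_⟩
    · rw [show i₀ - 1 + 1 = i₀ by omega, hi₀.2, hp0]
    · rw [hp0]; exact hmaxX i hi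
    · rw [hp0] at hiX; rw [show i₀ - 1 + 1 = i₀ by omega]
      exact le_max_of_le_right (hmaxH i hi hiX)

open Classical in
/-- The top cut time of a rooted polygon (`0` if there is none, i.e. never for `n ≥ 2`).
[cite: MadrasSlade1993, §3.2 (proof of Theorem 3.2.3: the lexicographically largest point)] -/
def jTop (n : ℕ) (ω : ℕ → Site 2) : ℕ :=
  if h : ∃ j, j < n ∧ ω (j + 1) 0 = ω j 0 ∧ (∀ i, i ≤ n → ω i 0 ≤ ω j 0) ∧
      (∀ i, i ≤ n → ω i 0 = ω j 0 → ω i 1 ≤ max (ω j 1) (ω (j + 1) 1)) then Classical.choose h else 0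

/-- Specification of `jTop`: a vertical walk bond of the rightmost column, above all other vertices of that column.
[cite: MadrasSlade1993, §3.2 (proof of Theorem 3.2.3)] -/
theorem jTop_spec (hω : ω ∈ endAt n (Pi.single 0 1 : Site 2)) (hn : 2 ≤ n) :
    jTop n ω < n ∧ ω (jTop n ω + 1) 0 = ω (jTop n ω) 0 ∧ (∀ i, i ≤ n → ω i 0 ≤ ω (jTop n ω) 0) ∧
      (∀ i, i ≤ n → ω i 0 = ω (jTop n ω) 0 → ω i 1 ≤ max (ω (jTop n ω) 1) (ω (jTop n ω + 1) 1)) := by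
  classical
  have h := exists_vertical_top hω hn
  unfold jTop; rw [dif_pos h]
  exact Classical.choose_spec h

end TopCut

/-! ### The second polygon minus its root bond, laid onto the cut bond -/

section SPath

variable {n m : ℕ} {ω υ : ℕ → Site 2} {j : ℕ}

/-- `2e₀`. [folklore; lane plumbing] [cite: MadrasSlade1993, §3.2 (proof of Theorem 3.2.3)] -/
private theorem ej_two_e0 : ((Pi.single 0 1 : Site 2) + (Pi.single 0 1 : Site 2) : Site 2) = Pi.single 0 2 := by
  rw [← Pi.single_add]; norm_num

/-- `(2e₀) 0 = 2`. [folklore; lane plumbing] [cite: MadrasSlade1993, §3.2] -/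
private theorem ej_t2_zero : ((Pi.single 0 2 : Site 2) : Site 2) 0 = 2 := by simp

/-- `(2e₀) 1 = 0`. [folklore; lane plumbing] [cite: MadrasSlade1993, §3.2] -/
private theorem ej_t2_one : ((Pi.single 0 2 : Site 2) : Site 2) 1 = 0 := by simp

/-- **The shared path**: the second polygon `υ` minus its root bond `{0, (0,1)}`, traversed from the end matching the cut bond's
direction and translated so that the root bond lands ON the cut bond `{ω j, ω (j+1)}` — the tree's `detour m ω υ j 0` (which lands it
two columns to the right) shifted back by `2e₀`. [cite: MadrasSlade1993, §3.2 (proof of Theorem 3.2.3: "translate `Q`")] -/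
def spath (m : ℕ) (ω υ : ℕ → Site 2) (j : ℕ) (s : ℕ) : Site 2 := detour m ω υ j 0 s - (Pi.single 0 2 : Site 2)

/-- `detour = spath + 2e₀`. [cite: MadrasSlade1993, §3.2 (proof of Theorem 3.2.3)] -/
theorem detour_eq_spath_add (s : ℕ) : detour m ω υ j 0 s = spath m ω υ j s + (Pi.single 0 2 : Site 2) := by
  simp [spath]

/-- The shared path starts at `ω j`. [cite: MadrasSlade1993, §3.2 (proof of Theorem 3.2.3)] -/
theorem spath_zero (hD : DetourOK m ω j (detour m ω υ j 0)) : spath m ω υ j 0 = ω j := by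
  rw [spath, hD.start, add_assoc, ej_two_e0, add_sub_cancel_right]

/-- The shared path ends at `ω (j+1)`. [cite: MadrasSlade1993, §3.2 (proof of Theorem 3.2.3)] -/
theorem spath_last (hD : DetourOK m ω j (detour m ω υ j 0)) : spath m ω υ j m = ω (j + 1) := by
  rw [spath, hD.finish, add_assoc, ej_two_e0, add_sub_cancel_right]

/-- Its steps are brick-wall bonds (a translate by the even vector `−2e₀`). [cite: EntingJensen2009, §7.4.2, Fig. 7.10 (brickwork form of the honeycomb lattice)] -/
theorem spath_adj (hD : DetourOK m ω j (detour m ω υ j 0)) {s : ℕ} (hs : s < m) :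
    brickWallGraph.Adj (spath m ω υ j s) (spath m ω υ j (s + 1)) := by
  have h := hD.adj s hs
  rw [detour_eq_spath_add, detour_eq_spath_add, adj_add_iff_of_even (by simp)] at h
  exact h

/-- It is self-avoiding on `[0, m]`. [cite: MadrasSlade1993, §3.2 (proof of Theorem 3.2.3)] -/
theorem spath_injOn (hD : DetourOK m ω j (detour m ω υ j 0)) : Set.InjOn (spath m ω υ j) {s | s ≤ m} := by
  intro s hs s' hs' h
  exact hD.inj hs hs' (by rw [detour_eq_spath_add, detour_eq_spath_add, h])

/-- It lies in the closed half-plane `{x ≥ X}` right of the cut column. [cite: MadrasSlade1993, §3.2 (proof of Theorem 3.2.3)] -/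
theorem spath_col (hD : DetourOK m ω j (detour m ω υ j 0)) {s : ℕ} (hs : s ≤ m) : ω j 0 ≤ spath m ω υ j s 0 := by
  have h := hD.col s hs
  rw [detour_eq_spath_add, Pi.add_apply, ej_t2_zero] at h
  omega

/-- **Its column-`X` vertices lie at or above the lower end of the cut bond**: `υ` is canonical, so its column-`0` vertices have
height `≥ 0`, and the translation takes `υ`'s root bond onto the cut bond. [cite: MadrasSlade1993, §3.2 (proof of Theorem 3.2.3: `Q[N]`)] -/
theorem spath_low (hadj : brickWallGraph.Adj (ω j) (ω (j + 1))) (hv : ω (j + 1) 0 = ω j 0)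
    (hυ : υ ∈ canonEnd m) (hm : 2 ≤ m) {s : ℕ} (hs : s ≤ m) (h0 : spath m ω υ j s 0 = ω j 0) :
    min (ω j 1) (ω (j + 1) 1) ≤ spath m ω υ j s 1 := by
  obtain ⟨hE, hlex⟩ := mem_canonEnd.1 hυ
  have hυ0 : υ 0 = 0 := (mem_endAt_iff.1 hE).1.1
  have h1 := apply_one_of_mem_canonEnd hυ hm
  have hvc := vertical_cases hadj hv
  -- every site of the cyclic traversals is some `υ c`, `c ≤ m`
  by_cases hsd : sameDir ω υ j 0 = true
  · obtain ⟨c, hc, hcs⟩ := cycB_exists (υ := υ) (p := 0) (Nat.zero_le m) s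
    have hsp : spath m ω υ j s = υ c + ω j := by
      rw [spath, detour_of_same hsd, hcs, hυ0, sub_zero, add_assoc, ej_two_e0, add_sub_assoc, add_sub_cancel_right]
    rw [hsp, Pi.add_apply] at h0 ⊢
    have hc0 : υ c 0 = 0 := by omega
    have hsd' : ω (j + 1) 1 - ω j 1 = 1 := by
      have := hsd; simp only [sameDir, zero_add, h1.2, hυ0, Pi.zero_apply, sub_zero, decide_eq_true_eq] at this; exact this
    rcases hlex c hc with h | ⟨-, h⟩
    · omega
    · rw [min_eq_left (by omega)]; omega
  · have hsd0 : sameDir ω υ j 0 = false := by simpa using hsd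
    obtain ⟨c, hc, hcs⟩ := cycF_exists (υ := υ) (m := m) (p := 0 + 1) (by omega) hs
    have hsp : spath m ω υ j s = υ c + (ω j - υ 1) := by
      rw [spath, detour_of_not_same hsd0, hcs, add_assoc, ej_two_e0]; abel
    rw [hsp, Pi.add_apply, Pi.sub_apply, h1.1] at h0
    rw [hsp, Pi.add_apply, Pi.sub_apply, h1.2]
    have hc0 : υ c 0 = 0 := by omega
    have hsd' : ω (j + 1) 1 - ω j 1 ≠ 1 := by
      have := hsd0; simp only [sameDir, zero_add, h1.2, hυ0, Pi.zero_apply, sub_zero, decide_eq_false_iff_not] at this; exact this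
    have hdown : ω j 1 = ω (j + 1) 1 + 1 := by
      rcases hvc with ⟨hy, -⟩ | ⟨hy, -⟩
      · exact absurd (by omega) hsd'
      · exact hy
    rcases hlex c hc with h | ⟨-, h⟩
    · omega
    · rw [min_eq_right (by omega)]; omega

/-- **The first step of the shared path goes RIGHT**: `spath 1 = ω j + e₀` lies in column `X + 1` (its left neighbour is excluded by
`spath_col`, and the vertical neighbour of `ω j` is `ω (j+1) = spath m ≠ spath 1`). [cite: EntingJensen2009, §7.4.2, Fig. 7.10] -/
theorem spath_one_col (hadj : brickWallGraph.Adj (ω j) (ω (j + 1))) (hv : ω (j + 1) 0 = ω j 0)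
    (hD : DetourOK m ω j (detour m ω υ j 0)) (hm : 2 ≤ m) : spath m ω υ j 1 0 = ω j 0 + 1 := by
  have h01 : brickWallGraph.Adj (ω j) (spath m ω υ j 1) := by
    have := spath_adj hD (show 0 < m by omega); rwa [spath_zero hD, zero_add] at this
  have hcol := spath_col hD (show 1 ≤ m by omega)
  rcases adj_cases h01 with ⟨h1, -⟩ | ⟨h1, -⟩ | h1
  · exact h1
  · omega
  · -- vertical neighbour of `ω j`: it is `ω (j+1) = spath m`, contradicting injectivity (`1 ≠ m`)
    have heq : spath m ω υ j 1 = ω (j + 1) := vertical_unique h01 hadj h1 hv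
    rw [← spath_last hD] at heq
    have := spath_injOn hD (show 1 ∈ {s | s ≤ m} by simp; omega) (show m ∈ {s | s ≤ m} by simp) heq
    omega

/-- **The last step of the shared path comes from the RIGHT**: `spath (m−1)` lies in column `X + 1`. [cite: EntingJensen2009, §7.4.2, Fig. 7.10] -/
theorem spath_pred_col (hadj : brickWallGraph.Adj (ω j) (ω (j + 1))) (hv : ω (j + 1) 0 = ω j 0)
    (hD : DetourOK m ω j (detour m ω υ j 0)) (hm : 2 ≤ m) : spath m ω υ j (m - 1) 0 = ω j 0 + 1 := by
  have hlast := spath_adj hD (show m - 1 < m by omega)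
  rw [show m - 1 + 1 = m by omega, spath_last hD] at hlast
  have hcol := spath_col hD (show m - 1 ≤ m by omega)
  rcases adj_cases hlast.symm with ⟨h1, -⟩ | ⟨h1, -⟩ | h1
  · omega
  · omega
  · have heq : spath m ω υ j (m - 1) = ω j := vertical_unique hlast.symm hadj.symm h1 (by omega)
    rw [← spath_zero hD] at heq
    have := spath_injOn hD (show m - 1 ∈ {s | s ≤ m} by simp) (show 0 ∈ {s | s ≤ m} by simp) heq
    omega

end SPath

/-! ### The merge -/

section Merge

variable {n m : ℕ} {ω π : ℕ → Site 2} {j : ℕ}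

/-- **The merged walk**: `ω` up to the cut time `j`, the shared path `π(0..m)` from `ω j` to `ω (j+1)`, then `ω` from time `j+1` on
(`n + m − 1` steps in all: one bond of each polygon is deleted, none is added). [cite: MadrasSlade1993, §3.2 (proof of Theorem 3.2.3, the concatenated polygon)] -/
def merge (m : ℕ) (ω π : ℕ → Site 2) (j : ℕ) (i : ℕ) : Site 2 :=
  if i ≤ j then ω i else if i ≤ j + m then π (i - j) else ω (i + 1 - m)

/-- Before the cut. [cite: MadrasSlade1993, §3.2 (proof of Theorem 3.2.3)] -/
theorem merge_of_le {i : ℕ} (h : i ≤ j) : merge m ω π j i = ω i := if_pos h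

/-- On the shared path (including both ends, given `π 0 = ω j`). [cite: MadrasSlade1993, §3.2 (proof of Theorem 3.2.3)] -/
theorem merge_mid (hπ0 : π 0 = ω j) {s : ℕ} (hs : s ≤ m) : merge m ω π j (j + s) = π s := by
  unfold merge
  rcases Nat.eq_zero_or_pos s with rfl | hs0
  · rw [if_pos (by omega), hπ0, add_zero]
  · rw [if_neg (by omega), if_pos (by omega), Nat.add_sub_cancel_left]

/-- After the shared path (including its end, given `π m = ω (j+1)`). [cite: MadrasSlade1993, §3.2 (proof of Theorem 3.2.3)] -/
theorem merge_of_ge (hπm : π m = ω (j + 1)) (hm : 1 ≤ m) {i : ℕ} (h : j + m ≤ i) : merge m ω π j i = ω (i + 1 - m) := by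
  unfold merge
  rw [if_neg (by omega)]
  rcases eq_or_lt_of_le h with rfl | hlt
  · rw [if_pos le_rfl, Nat.add_sub_cancel_left, hπm]; congr 1; omega
  · rw [if_neg (by omega)]

/-- Hypotheses of the merge on the shared path `π`. [cite: MadrasSlade1993, §3.2 (proof of Theorem 3.2.3)] -/
structure SPathOK (m : ℕ) (ω : ℕ → Site 2) (j : ℕ) (π : ℕ → Site 2) : Prop where
  start : π 0 = ω j
  finish : π m = ω (j + 1)
  adj : ∀ s, s < m → brickWallGraph.Adj (π s) (π (s + 1))
  inj : Set.InjOn π {s | s ≤ m}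
  col : ∀ s, s ≤ m → ω j 0 ≤ π s 0
  low : ∀ s, s ≤ m → π s 0 = ω j 0 → min (ω j 1) (ω (j + 1) 1) ≤ π s 1

/-- The shared path built from a canonical `υ` satisfies the hypotheses. [cite: MadrasSlade1993, §3.2 (proof of Theorem 3.2.3)] -/
theorem spathOK {υ : ℕ → Site 2} (hω : ω ∈ endAt n (Pi.single 0 1 : Site 2)) (hj : j < n) (hv : ω (j + 1) 0 = ω j 0)
    (hυ : υ ∈ canonEnd m) (hm : 2 ≤ m) : SPathOK m ω j (spath m ω υ j) := by
  have hD := detourOK_zero hω hj hv hυ hm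
  exact ⟨spath_zero hD, spath_last hD, fun s hs => spath_adj hD hs, spath_injOn hD, fun s hs => spath_col hD hs,
    fun s hs h0 => spath_low (adj_of_mem hω hj) hv hυ hm hs h0⟩

/-- **The merge is a rooted `(n+m)`-gon**: for `ω ∈ E_n(e₀)` cut at a top bond `{ω j, ω (j+1)}` of its rightmost column (`hX`, `hT`)
and a shared path satisfying `SPathOK`, `merge m ω π j ∈ E_{n+m−1}(e₀)`.  Self-avoidance: a site common to `ω` and the interior of
`π` lies in column `X` (`hX`, `col`) at height `≤ y+1` (`hT`) and `≥ y` (`low`), so it is an endpoint of the cut bond — excluded on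
both sides by injectivity. [cite: MadrasSlade1993, §3.2 (proof of Theorem 3.2.3: "the result is a self-avoiding polygon")] -/
theorem merge_mem (hω : ω ∈ endAt n (Pi.single 0 1 : Site 2)) (hj : j < n) (hm : 2 ≤ m)
    (hX : ∀ i, i ≤ n → ω i 0 ≤ ω j 0) (hT : ∀ i, i ≤ n → ω i 0 = ω j 0 → ω i 1 ≤ max (ω j 1) (ω (j + 1) 1))
    (hP : SPathOK m ω j π) : merge m ω π j ∈ endAt (n + m - 1) (Pi.single 0 1 : Site 2) := by
  obtain ⟨⟨h0, hfr, hbw, hinj⟩, hn'⟩ := mem_endAt_iff.1 hω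
  have hωle : ∀ i, ω i = ω (min i n) := fun i => by
    rcases le_or_gt i n with hi | hi
    · rw [min_eq_left hi]
    · rw [min_eq_right hi.le, hfr i hi.le]
  -- values after the window
  have hge : ∀ i, j + m ≤ i → merge m ω π j i = ω (i + 1 - m) := fun i hi => merge_of_ge hP.finish (by omega) hi
  rw [mem_endAt_iff]
  refine ⟨⟨by rw [merge_of_le (Nat.zero_le _), h0], ?_, ?_, ?_⟩, ?_⟩
  · -- frozen after `n + m - 1`
    intro i hi
    rw [hge i (by omega), hge (n + m - 1) (by omega), hfr _ (by omega), hfr (n + m - 1 + 1 - m) (by omega)]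
  · -- steps
    intro i hi
    rcases Nat.lt_or_ge i j with h1 | h1
    · rw [merge_of_le h1.le, merge_of_le (by omega)]; exact hbw i (by omega)
    rcases Nat.lt_or_ge i (j + m) with h2 | h2
    · obtain ⟨s, rfl⟩ : ∃ s, i = j + s := ⟨i - j, by omega⟩
      rw [merge_mid hP.start (by omega), show j + s + 1 = j + (s + 1) by omega, merge_mid hP.start (by omega)]
      exact hP.adj s (by omega)
    · rw [hge i h2, hge (i + 1) (by omega), show i + 1 + 1 - m = i + 1 - m + 1 by omega]
      exact hbw _ (by omega)
  · -- injective on `[0, n+m-1]`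
    -- the `ω`-index of a time outside the window
    have hout : ∀ i, i ≤ n + m - 1 → (i ≤ j ∨ j + m ≤ i) →
        ∃ a, a ≤ n ∧ merge m ω π j i = ω a ∧ (i ≤ j → a = i) ∧ (j + m ≤ i → a = i + 1 - m) := by
      intro i hi hio
      rcases hio with h1 | h1
      · exact ⟨i, by omega, merge_of_le h1, fun _ => rfl, fun h => by omega⟩
      · exact ⟨i + 1 - m, by omega, hge i h1, fun h => by omega, fun _ => rfl⟩
    -- a common site of `ω` and the interior of `π` is impossible
    have hcross : ∀ a s, a ≤ n → 1 ≤ s → s ≤ m - 1 → ω a ≠ π s := by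
      intro a s ha hs1 hs2 heq
      have hc0 : π s 0 = ω j 0 := le_antisymm (by rw [← heq]; exact hX a ha) (hP.col s (by omega))
      have hlow := hP.low s (by omega) hc0
      have htop : π s 1 ≤ max (ω j 1) (ω (j + 1) 1) := by rw [← heq]; exact hT a ha (by rw [heq]; exact hc0)
      have hvv := vertical_cases (hbw j hj) (by
        have := hP.finish; have := hP.start; exact (show ω (j + 1) 0 = ω j 0 from by
          have h := hP.col m le_rfl; rw [hP.finish] at h
          have h' := hX (j + 1) (by omega); omega))
      -- so `π s` is `ω j` or `ω (j+1)`
      have hor : π s = π 0 ∨ π s = π m := by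
        rw [hP.start, hP.finish, ej_site_eq_iff, ej_site_eq_iff]
        have hf0 : ω (j + 1) 0 = ω j 0 := by
          have h := hP.col m le_rfl; rw [hP.finish] at h; have h' := hX (j + 1) (by omega); omega
        rcases hvv with ⟨hy, -⟩ | ⟨hy, -⟩
        · rw [min_eq_left (by omega)] at hlow; rw [max_eq_right (by omega)] at htop
          by_cases hh : π s 1 = ω j 1
          · exact Or.inl ⟨hc0, hh⟩
          · exact Or.inr ⟨by rw [hc0, hf0], by omega⟩
        · rw [min_eq_right (by omega)] at hlow; rw [max_eq_left (by omega)] at htop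
          by_cases hh : π s 1 = ω j 1
          · exact Or.inl ⟨hc0, hh⟩
          · exact Or.inr ⟨by rw [hc0, hf0], by omega⟩
      rcases hor with h | h
      · have := hP.inj (show s ∈ {s | s ≤ m} by simp; omega) (show 0 ∈ {s | s ≤ m} by simp) h; omega
      · have := hP.inj (show s ∈ {s | s ≤ m} by simp; omega) (show m ∈ {s | s ≤ m} by simp) h; omega
    -- case analysis on the two times
    suffices key : ∀ i i', i < i' → i' ≤ n + m - 1 → merge m ω π j i ≠ merge m ω π j i' by
      intro i hi i' hi' h
      simp only [Set.mem_setOf_eq] at hi hi'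
      by_contra hne
      rcases Nat.lt_or_gt_of_ne hne with hlt | hlt
      · exact key i i' hlt hi' h
      · exact key i' i hlt hi h.symm
    intro i i' hlt hi' h
    by_cases hwi : j < i ∧ i < j + m <;> by_cases hwi' : j < i' ∧ i' < j + m
    · -- both on the interior of the path
      obtain ⟨s, rfl⟩ : ∃ s, i = j + s := ⟨i - j, by omega⟩
      obtain ⟨s', rfl⟩ : ∃ s', i' = j + s' := ⟨i' - j, by omega⟩
      rw [merge_mid hP.start (by omega), merge_mid hP.start (by omega)] at h
      have := hP.inj (show s ∈ {s | s ≤ m} by simp; omega) (show s' ∈ {s | s ≤ m} by simp; omega) h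
      omega
    · -- `i` inside, `i'` outside
      obtain ⟨s, rfl⟩ : ∃ s, i = j + s := ⟨i - j, by omega⟩
      obtain ⟨a, ha, hia, -, -⟩ := hout i' hi' (by omega)
      rw [merge_mid hP.start (by omega), hia] at h
      exact hcross a s ha (by omega) (by omega) h.symm
    · -- `i` outside, `i'` inside
      obtain ⟨s', rfl⟩ : ∃ s', i' = j + s' := ⟨i' - j, by omega⟩
      obtain ⟨a, ha, hia, -, -⟩ := hout i (by omega) (by omega)
      rw [merge_mid hP.start (by omega), hia] at h
      exact hcross a s' ha (by omega) (by omega) h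
    · -- both outside: read off `ω`
      obtain ⟨a, ha, hia, ha1, ha2⟩ := hout i (by omega) (by omega)
      obtain ⟨a', ha', hia', ha1', ha2'⟩ := hout i' hi' (by omega)
      rw [hia, hia'] at h
      have haa := hinj (show a ∈ {i | i ≤ n} by simpa using ha) (show a' ∈ {i | i ≤ n} by simpa using ha') h
      -- `a < a'`
      have : a < a' := by
        rcases le_or_gt i j with h1 | h1 <;> rcases le_or_gt i' j with h2 | h2
        · rw [ha1 h1, ha1' h2]; exact hlt
        · rw [ha1 h1, ha2' (by omega)]; omega
        · omega
        · rw [ha2 (by omega), ha2' (by omega)]; omega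
      omega
  · -- endpoint
    rw [hge (n + m - 1) (by omega), show n + m - 1 + 1 - m = n by omega, hn']

/-- **The merge of canonical polygons is canonical**: all its sites are lexicographically `≥ 0` (the shared path lies in
`{x ≥ X} ⊆ {x ≥ 1}`). [cite: MadrasSlade1993, §3.2 (proof of Theorem 3.2.3: the result lies in `Q[N+M]`)] -/
theorem merge_mem_canonEnd (hω : ω ∈ canonEnd n) (hj : j < n) (hm : 2 ≤ m)
    (hX : ∀ i, i ≤ n → ω i 0 ≤ ω j 0) (hT : ∀ i, i ≤ n → ω i 0 = ω j 0 → ω i 1 ≤ max (ω j 1) (ω (j + 1) 1))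
    (hP : SPathOK m ω j π) : merge m ω π j ∈ canonEnd (n + m - 1) := by
  obtain ⟨hE, hlex⟩ := mem_canonEnd.1 hω
  have hn' := (mem_endAt_iff.1 hE).2
  have hX1 : 1 ≤ ω j 0 := by have := hX n le_rfl; rw [hn'] at this; simpa using this
  refine mem_canonEnd.2 ⟨merge_mem hE hj hm hX hT hP, fun i hi => ?_⟩
  rcases le_or_gt i j with h1 | h1
  · rw [merge_of_le h1]; exact hlex i (by omega)
  rcases Nat.lt_or_ge i (j + m) with h2 | h2
  · obtain ⟨s, rfl⟩ : ∃ s, i = j + s := ⟨i - j, by omega⟩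
    rw [merge_mid hP.start (by omega)]
    left; have := hP.col s (by omega); omega
  · rw [merge_of_ge hP.finish (by omega) h2]; exact hlex _ (by omega)

end Merge

/-! ### Decoding: the cut time is read off the merged walk -/

section Decode

variable {n m : ℕ} {ω ω' π π' : ℕ → Site 2} {j j' : ℕ}

/-- **The cut time is determined by the merged walk** (the tree's argument for `glue`, verbatim): right after its cut the first walk
is in column `X + 1` (`hπ1`), so `X + 1 ≤ X'` if `j < j'`; right before re-entering `ω'` the second walk is in column `X' + 1` (`hπ'`)
while the first is back on `ω`, in a column `≤ X` — impossible. [cite: MadrasSlade1993, §3.2 (proof of Theorem 3.2.3: "the `N` sites with smallest first coordinate are precisely the points of `P`")] -/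
theorem merge_cut_le (hj' : j' < n) (hm : 2 ≤ m) (hP : SPathOK m ω j π) (hP' : SPathOK m ω' j' π')
    (hX : ∀ i, i ≤ n → ω i 0 ≤ ω j 0) (hX' : ∀ i, i ≤ n → ω' i 0 ≤ ω' j' 0)
    (hπ1 : π 1 0 = ω j 0 + 1) (hπ' : π' (m - 1) 0 = ω' j' 0 + 1)
    (h : ∀ i, i ≤ n + m - 1 → merge m ω π j i = merge m ω' π' j' i) : j' ≤ j := by
  by_contra hlt
  push Not at hlt
  -- time `j + 1`
  have h1 := h (j + 1) (by omega)
  rw [show j + 1 = j + 1 from rfl, merge_mid hP.start (show 1 ≤ m by omega), merge_of_le (show j + 1 ≤ j' by omega)] at h1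
  have hc1 : ω' (j + 1) 0 = ω j 0 + 1 := by rw [← h1]; exact hπ1
  have hle1 := hX' (j + 1) (by omega)
  -- time `j' + (m - 1)`
  have h2 := h (j' + (m - 1)) (by omega)
  rw [merge_mid hP'.start (show m - 1 ≤ m by omega), merge_of_ge hP.finish (by omega) (show j + m ≤ j' + (m - 1) by omega)] at h2
  have hc2 : ω (j' + (m - 1) + 1 - m) 0 = ω' j' 0 + 1 := by rw [h2]; exact hπ'
  have hle2 := hX (j' + (m - 1) + 1 - m) (by omega)
  omega

/-- **`ω` is read off outside the window** once the cut times agree. [cite: MadrasSlade1993, §3.2 (proof of Theorem 3.2.3: reconstruction of `P`)] -/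
theorem left_eq_of_merge_eq (hω : ω ∈ endAt n (Pi.single 0 1 : Site 2)) (hω' : ω' ∈ endAt n (Pi.single 0 1 : Site 2)) (hj : j < n)
    (hm : 1 ≤ m) (hP : SPathOK m ω j π) (hP' : SPathOK m ω' j π')
    (h : ∀ i, i ≤ n + m - 1 → merge m ω π j i = merge m ω' π' j i) : ω = ω' := by
  have h1 : ∀ i, i ≤ n → ω i = ω' i := by
    intro i hi
    rcases le_or_gt i j with hij | hij
    · have := h i (by omega); rwa [merge_of_le hij, merge_of_le hij] at this
    · have := h (i + m - 1) (by omega)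
      rwa [merge_of_ge hP.finish hm (by omega), merge_of_ge hP'.finish hm (by omega),
        show i + m - 1 + 1 - m = i by omega] at this
  funext i
  rcases le_or_gt i n with hi | hi
  · exact h1 i hi
  · rw [(mem_endAt_iff.1 hω).1.2.1 i hi.le, (mem_endAt_iff.1 hω').1.2.1 i hi.le]; exact h1 n le_rfl

/-- The shared paths agree on `[0, m]` once `ω` and the cut time agree. [cite: MadrasSlade1993, §3.2 (proof of Theorem 3.2.3: reconstruction of `Q`)] -/
theorem spath_eq_of_merge_eq (hP : SPathOK m ω j π) (hP' : SPathOK m ω j π')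
    (h : ∀ i, i ≤ n + m - 1 → merge m ω π j i = merge m ω π' j i) (hj : j < n) : ∀ s, s ≤ m → π s = π' s := by
  intro s hs
  have := h (j + s) (by omega)
  rwa [merge_mid hP.start hs, merge_mid hP'.start hs] at this

end Decode

/-! ### The edge join and its injectivity -/

section Join

variable {n m : ℕ} {ω υ : ℕ → Site 2}

/-- **The edge join** of canonical `ω ∈ canonEnd n` and `υ ∈ canonEnd m`: the merge at the top cut of `ω` with the shared path of `υ`.
[cite: MadrasSlade1993, §3.2 (proof of Theorem 3.2.3, the concatenation of `P ∈ Q[N]` and `Q`)] -/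
def ejoin (n m : ℕ) (ω υ : ℕ → Site 2) : ℕ → Site 2 :=
  merge m ω (spath m ω υ (jTop n ω)) (jTop n ω)

/-- `ejoin` maps `canonEnd n × canonEnd m` into `canonEnd (n+m−1)` (`n, m ≥ 2`).
[cite: MadrasSlade1993, §3.2 (proof of Theorem 3.2.3: "the result is a self-avoiding polygon in `Q[N+M]`")] -/
theorem ejoin_mem_canonEnd (hω : ω ∈ canonEnd n) (hυ : υ ∈ canonEnd m) (hn : 2 ≤ n) (hm : 2 ≤ m) :
    ejoin n m ω υ ∈ canonEnd (n + m - 1) := by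
  obtain ⟨hE, -⟩ := mem_canonEnd.1 hω
  obtain ⟨hj, hv, hX, hT⟩ := jTop_spec hE hn
  exact merge_mem_canonEnd hω hj hm hX hT (spathOK hE hj hv hυ hm)

/-- **The edge join is injective on `canonEnd n × canonEnd m`** (`n, m ≥ 2`).
[cite: MadrasSlade1993, §3.2 (proof of Theorem 3.2.3: "we can reconstruct `P` and `Q`")] -/
theorem ejoin_injOn (hn : 2 ≤ n) (hm : 2 ≤ m) :
    Set.InjOn (fun p : (ℕ → Site 2) × (ℕ → Site 2) => ejoin n m p.1 p.2) ↑(canonEnd n ×ˢ canonEnd m) := by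
  rintro ⟨ω, υ⟩ hp ⟨ω', υ'⟩ hp' hW
  rw [Finset.coe_product, Set.mem_prod, Finset.mem_coe, Finset.mem_coe] at hp hp'
  obtain ⟨hω, hυ⟩ := hp
  obtain ⟨hω', hυ'⟩ := hp'
  dsimp only at hω hυ hω' hυ' hW
  obtain ⟨hE, -⟩ := mem_canonEnd.1 hω
  obtain ⟨hE', -⟩ := mem_canonEnd.1 hω'
  obtain ⟨hj, hv, hX, hT⟩ := jTop_spec hE hn
  obtain ⟨hj', hv', hX', hT'⟩ := jTop_spec hE' hn
  have hD := detourOK_zero hE hj hv hυ hm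
  have hD' := detourOK_zero hE' hj' hv' hυ' hm
  have hP := spathOK hE hj hv hυ hm
  have hP' := spathOK hE' hj' hv' hυ' hm
  have hadj := adj_of_mem hE hj
  have hadj' := adj_of_mem hE' hj'
  have hW' : ∀ i, i ≤ n + m - 1 → merge m ω (spath m ω υ (jTop n ω)) (jTop n ω) i =
      merge m ω' (spath m ω' υ' (jTop n ω')) (jTop n ω') i := fun i _ => congrFun hW i
  -- equal cut times
  have hjj : jTop n ω = jTop n ω' :=
    le_antisymm
      (merge_cut_le hj hm hP' hP hX' hX (spath_one_col hadj' hv' hD' hm) (spath_pred_col hadj hv hD hm)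
        fun i hi => (hW' i hi).symm)
      (merge_cut_le hj' hm hP hP' hX hX' (spath_one_col hadj hv hD hm) (spath_pred_col hadj' hv' hD' hm) hW')
  rw [← hjj] at hW' hP'
  have hωω : ω = ω' := left_eq_of_merge_eq hE hE' hj (by omega) hP hP' hW'
  subst hωω
  refine Prod.ext rfl ?_
  -- decode `υ` from the shared path
  have hsp := spath_eq_of_merge_eq hP hP' hW' hj
  have hD2 : ∀ i, i ≤ m → detour m ω υ (jTop n ω) 0 i = detour m ω υ' (jTop n ω) 0 i := fun i hi => by
    rw [detour_eq_spath_add, detour_eq_spath_add, hsp i hi]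
  -- the direction bit depends on `ω` only (both `υ`, `υ'` start with the step `(0,1)`)
  have h1 := apply_one_of_mem_canonEnd hυ hm
  have h1' := apply_one_of_mem_canonEnd hυ' hm
  obtain ⟨hF, -⟩ := mem_canonEnd.1 hυ
  obtain ⟨hF', -⟩ := mem_canonEnd.1 hυ'
  have h0 : υ 0 = 0 := (mem_endAt_iff.1 hF).1.1
  have h0' : υ' 0 = 0 := (mem_endAt_iff.1 hF').1.1
  have hb : sameDir ω υ (jTop n ω) 0 = sameDir ω υ' (jTop n ω) 0 := by
    simp only [sameDir, zero_add, h1.2, h1'.2, h0, h0']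
  exact detour_decode hF hF' (by omega) hb hD2

end Join

/-! ### Counting -/

section Count

variable {n m : ℕ}

/-- **Sharp supermultiplicativity, canonical rooted form**: `#canonEnd n · #canonEnd m ≤ #canonEnd (n+m−1)` (`n, m ≥ 2`).
[cite: MadrasSlade1993, Theorem 3.2.3 (3.2.2) p. 64] -/
theorem card_canonEnd_mul_le_sharp (hn : 2 ≤ n) (hm : 2 ≤ m) : #(canonEnd n) * #(canonEnd m) ≤ #(canonEnd (n + m - 1)) := by
  classical
  have hmaps : Set.MapsTo (fun p : (ℕ → Site 2) × (ℕ → Site 2) => ejoin n m p.1 p.2) ↑(canonEnd n ×ˢ canonEnd m)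
      ↑(canonEnd (n + m - 1)) := by
    rintro ⟨ω, υ⟩ hp
    rw [Finset.coe_product, Set.mem_prod, Finset.mem_coe, Finset.mem_coe] at hp
    exact ejoin_mem_canonEnd hp.1 hp.2 hn hm
  have h := Finset.card_le_card_of_injOn _ hmaps (ejoin_injOn hn hm)
  rwa [Finset.card_product] at h

end Count

end PolygonConcat

open PolygonConcat

variable {N M : ℕ}

/-- **Sharp supermultiplicativity on the honeycomb lattice: `q_N(ℍ) · q_M(ℍ) ≤ q_{N+M−2}(ℍ)`** for all `N, M ≥ 3` (both sides
vanish unless `N, M` are even) — the two polygons merged along one shared bond (the topmost bond of the first polygon's rightmost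
column, the bottom bond of the second's leftmost column).  Implies the tree's `hexPolygonNumber_mul_le` (`+2`) by `q_K ≤ q_{K+4}`.
[cite: MadrasSlade1993, Theorem 3.2.3 (3.2.2) p. 64 (ℤ^d, length-additive join; the bond-sharing edition on ℍ proved here)]
[cite: Whittington2009LatticePolygons, Theorem 1 and (2.3), pp. 25–26 (hypercubic)] -/
theorem hexPolygonNumber_mul_le_sharp (hN : 3 ≤ N) (hM : 3 ≤ M) :
    hexPolygonNumber N * hexPolygonNumber M ≤ hexPolygonNumber (N + M - 2) := by
  obtain ⟨n, rfl⟩ : ∃ n, N = n + 1 := ⟨N - 1, by omega⟩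
  obtain ⟨m, rfl⟩ : ∃ m, M = m + 1 := ⟨M - 1, by omega⟩
  rw [← card_canonEnd (by omega), ← card_canonEnd (by omega), show n + 1 + (m + 1) - 2 = n + m - 1 + 1 by omega,
    ← card_canonEnd (by omega)]
  exact card_canonEnd_mul_le_sharp (by omega) (by omega)

/-- **`q_N(ℍ) ≤ q_{N+M−2}(ℍ)` whenever `q_M(ℍ) > 0`** (`N, M ≥ 3`). [cite: MadrasSlade1993, Theorem 3.2.3 (3.2.2)–(3.2.3) p. 64] -/
theorem hexPolygonNumber_le_add_sub_two_of_pos (hN : 3 ≤ N) (hM : 3 ≤ M) (hpos : 0 < hexPolygonNumber M) :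
    hexPolygonNumber N ≤ hexPolygonNumber (N + M - 2) :=
  le_trans (Nat.le_mul_of_pos_right _ hpos) (hexPolygonNumber_mul_le_sharp hN hM)

/-- **Iterated sharp supermultiplicativity**: `q_N(ℍ)^k ≤ q_{k(N−2)+2}(ℍ)` (`N ≥ 3`, `k ≥ 1`).
[cite: MadrasSlade1993, §3.2 p. 65 (ℤ^d: the superadditivity behind (3.2.5))] -/
theorem hexPolygonNumber_pow_le_sharp (hN : 3 ≤ N) {k : ℕ} (hk : 1 ≤ k) :
    hexPolygonNumber N ^ k ≤ hexPolygonNumber (k * (N - 2) + 2) := by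
  induction k, hk using Nat.le_induction with
  | base => rw [pow_one, show 1 * (N - 2) + 2 = N by omega]
  | succ k hk ih =>
    calc hexPolygonNumber N ^ (k + 1) = hexPolygonNumber N ^ k * hexPolygonNumber N := pow_succ _ _
      _ ≤ hexPolygonNumber (k * (N - 2) + 2) * hexPolygonNumber N := Nat.mul_le_mul_right _ ih
      _ ≤ hexPolygonNumber (k * (N - 2) + 2 + N - 2) := by
          have h1 : 1 ≤ k * (N - 2) := by simpa using Nat.mul_le_mul hk (show 1 ≤ N - 2 by omega)
          exact hexPolygonNumber_mul_le_sharp (by omega) hN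
      _ = hexPolygonNumber ((k + 1) * (N - 2) + 2) := by
          congr 1; rw [Nat.succ_mul]; omega

/-- **Madras–Slade (3.2.5) on the honeycomb lattice, sharp form: `q_N(ℍ) ≤ μ_ℍ^{N−2}` for every `N ≥ 3`** (the tree's
`hexPolygonNumber_le_pow` has `μ_ℍ^{N+2}`): `q_N^k ≤ q_{k(N−2)+2} ≤ μ_ℍ^{k(N−2)+4}` for every `k`, and `k → ∞`.
[cite: MadrasSlade1993, (3.2.5) p. 65 (ℤ^d: q_N ≤ (d−1) μ^N)] [cite: Whittington2009LatticePolygons, (2.6) p. 26] -/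
theorem hexPolygonNumber_le_pow_sharp (hN : 3 ≤ N) : (hexPolygonNumber N : ℝ) ≤ hexConnectiveConstant ^ (N - 2) := by
  set μ : ℝ := hexConnectiveConstant with hμ
  have hμ1 : 1 ≤ μ := one_le_hexConnectiveConstant
  have hμ0 : 0 < μ := by positivity
  set q : ℝ := (hexPolygonNumber N : ℝ) with hq
  set b : ℝ := μ ^ (N - 2) with hb
  have hb0 : 0 < b := by positivity
  -- `q^k ≤ b^k · μ^4` for every `k ≥ 1`
  have hk : ∀ k : ℕ, 1 ≤ k → q ^ k ≤ b ^ k * μ ^ 4 := by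
    intro k hk1
    have h1 : q ^ k ≤ (hexPolygonNumber (k * (N - 2) + 2) : ℝ) := by
      rw [hq]; exact_mod_cast hexPolygonNumber_pow_le_sharp hN hk1
    have hk3 : 3 ≤ k * (N - 2) + 2 := by
      have : 1 ≤ k * (N - 2) := by simpa using Nat.mul_le_mul hk1 (show 1 ≤ N - 2 by omega)
      omega
    have h2 : (hexPolygonNumber (k * (N - 2) + 2) : ℝ) ≤ μ ^ (k * (N - 2) + 2 + 2) := hexPolygonNumber_le_pow hk3
    calc q ^ k ≤ μ ^ (k * (N - 2) + 2 + 2) := h1.trans h2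
      _ = b ^ k * μ ^ 4 := by rw [hb, ← pow_mul, ← pow_add]; congr 1; ring
  by_contra hlt
  push Not at hlt
  -- `r = q / b > 1`, `r^k ≤ μ^4` for all `k`: impossible
  have hq0 : 0 < q := hb0.trans hlt
  set r : ℝ := q / b with hr
  have hr1 : 1 < r := by rw [hr, one_lt_div hb0]; exact hlt
  have hrk : ∀ k : ℕ, 1 ≤ k → r ^ k ≤ μ ^ 4 := by
    intro k hk1
    rw [hr, div_pow, div_le_iff₀ (by positivity)]
    calc q ^ k ≤ b ^ k * μ ^ 4 := hk k hk1
      _ = μ ^ 4 * b ^ k := mul_comm _ _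
  have htend := tendsto_pow_atTop_atTop_of_one_lt hr1
  obtain ⟨k, hk1, hk2⟩ := ((htend.eventually (eventually_gt_atTop (μ ^ 4))).and (eventually_ge_atTop 1)).exists
  exact absurd (hrk k hk2) (not_le.2 hk1)

/-- **`q_N(ℍ) ≤ (2+√2)^{N/2−1}`-type bound**: `q_N(ℍ) ≤ √(2+√2)^{N−2}` with Duminil-Copin–Smirnov's value `μ_ℍ = √(2+√2)`.
[cite: MadrasSlade1993, (3.2.5) p. 65] [cite: DuminilCopinSmirnov2012, Theorem 1] -/
theorem hexPolygonNumber_le_sqrt_pow_sharp (hN : 3 ≤ N) :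
    (hexPolygonNumber N : ℝ) ≤ Real.sqrt (2 + Real.sqrt 2) ^ (N - 2) := by
  rw [← hexConnectiveConstant_eq_of_thm1 DuminilCopinSmirnov2012_thm1_holds]
  exact hexPolygonNumber_le_pow_sharp hN


end HexBW

end Literature.Probability.RandomPlanarGeometry.SAW

end
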